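import Literature.NumberTheory.Automorphic.BianchiConeModel
import Mathlib.Analysis.SpecialFunctions.Sqrt
import HarnessLib

/-!
# Horoball cones in the cone of binary Hermitian forms: convexity and the product inequality

Topic `NumberTheory/Automorphic`; namespace `Literature.NumberTheory.Automorphic`, grouping
sub-namespace `BianchiCone`.  Definitions with body (`rdet`, `det2`, `coer`) and theorems;
sequel of `BianchiConeModel`.

For `H = (p z; z̄ r)` in the cone `𝒫` of positive definite binary Hermitian forms put
`rdet H = √(p r - |z|²)`.  The DEPTH of `H` at the cusp of a vector `v` is (up to the arithmetic
normalisation of `BianchiCusp…`) `H[v] / rdet H`, a function homogeneous of degree `0`, and the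
HOROBALL CONE at `v` of parameter `s` is `{H ∈ 𝒫 | H[v] < s · rdet H}`
([ElstrodtGrunewaldMennicke1998, Ch. 1 §1.1, Ch. 2 §2.3: horoballs and the distance to a cusp]).
We prove, by explicit `2 × 2` algebra:

* `rdet_add_le` — **`√det` is superadditive on the cone**, `rdet H + rdet H' ≤ rdet (H + H')`
  (the `2 × 2` Minkowski determinant inequality: reverse Cauchy–Schwarz
  `√(pr)√(p'r') - |z||z'| ≥ √((pr - |z|²)(p'r' - |z'|²))`);
* `convex_horoballCone` — **horoball cones are convex** (`s ≥ 0`);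
* `qf_mul_qf_ge` — **the product inequality** `H[v] · H[w] ≥ det H · |v₀ w₁ - v₁ w₀|²`
  (completing the square and `(P x x' - Q y y')² ≥ 0`), the source of the disjointness of the
  horoballs at distinct cusps;
* `qf_ge_coer` — a coercivity bound `H[v] ≥ coer H · (|v₀|² + |v₁|²)` with `coer H > 0` explicit
  and continuous (`coer_pos`, `continuous_coer`), and `rdet_act`, `rdet_smul`.

## References

* J. Elstrodt, F. Grunewald, J. Mennicke, *Groups Acting on Hyperbolic Space* (1998), Ch. 1 §1.1,
  Ch. 2 §2.3 [ElstrodtGrunewaldMennicke1998].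
-/

noncomputable section

open Matrix Complex
open scoped MatrixGroups ComplexConjugate

namespace Literature.NumberTheory.Automorphic

namespace BianchiCone

/-! ### `√det` -/

/-- **`rdet H = √(p r - |z|²)`.** [cite: ElstrodtGrunewaldMennicke1998, Ch. 1 §1.1] -/
def rdet (H : Mat) : ℝ :=
  Real.sqrt (hdet H)

/-- `rdet` is positive on the cone. [folklore] -/
theorem rdet_pos {H : Mat} (hH : H ∈ cone) : 0 < rdet H :=
  Real.sqrt_pos.2 hH.2.2

/-- `rdet ≥ 0`. [folklore] -/
theorem rdet_nonneg (H : Mat) : 0 ≤ rdet H :=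
  Real.sqrt_nonneg _

/-- `rdet H ^ 2 = hdet H` on the cone. [folklore] -/
theorem rdet_sq {H : Mat} (hH : H ∈ cone) : rdet H ^ 2 = hdet H :=
  Real.sq_sqrt hH.2.2.le

/-- `hdet (t • H) = t² hdet H`. [folklore] -/
theorem hdet_smul (t : ℝ) (H : Mat) : hdet (t • H) = t ^ 2 * hdet H := by
  simp only [hdet, Matrix.smul_apply, Complex.real_smul, Complex.mul_re, Complex.ofReal_re,
    Complex.ofReal_im, zero_mul, sub_zero, Complex.normSq_mul, Complex.normSq_ofReal]
  ring

/-- `rdet (t • H) = t rdet H` for `t ≥ 0`. [folklore] -/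
theorem rdet_smul {t : ℝ} (ht : 0 ≤ t) (H : Mat) : rdet (t • H) = t * rdet H := by
  rw [rdet, rdet, hdet_smul, Real.sqrt_mul (sq_nonneg t), Real.sqrt_sq ht]

/-- `rdet` transforms by `|det g|⁻¹`. [cite: ElstrodtGrunewaldMennicke1998, Ch. 1 §1.3] -/
theorem rdet_act (g : GL (Fin 2) ℂ) {H : Mat} (hH : H.IsHermitian) :
    rdet (act g H) = rdet H / ‖(g : Mat).det‖ := by
  rw [rdet, rdet, hdet_act g hH, Complex.normSq_eq_norm_sq, Real.sqrt_div' _ (sq_nonneg _),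
    Real.sqrt_sq (norm_nonneg _)]

/-- Positive multiples of elements of the cone lie in the cone. [folklore] -/
theorem smul_mem_cone {t : ℝ} (ht : 0 < t) {H : Mat} (hH : H ∈ cone) : t • H ∈ cone := by
  refine ⟨isHermitian_smul_real hH.1 t, ?_, ?_⟩
  · simp only [Matrix.smul_apply, Complex.real_smul, Complex.mul_re, Complex.ofReal_re,
      Complex.ofReal_im, zero_mul, sub_zero]
    exact mul_pos ht hH.2.1
  · rw [hdet_smul]
    exact mul_pos (pow_pos ht 2) hH.2.2

/-- The cone is closed under addition. [folklore] -/
theorem add_mem_cone {H H' : Mat} (hH : H ∈ cone) (hH' : H' ∈ cone) : H + H' ∈ cone := by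
  rw [mem_cone_iff_forall_qf_pos] at hH hH' ⊢
  exact ⟨hH.1.add hH'.1, fun v hv => by rw [qf_add]; exact add_pos (hH.2 v hv) (hH'.2 v hv)⟩

/-- On the cone the second diagonal entry is positive too. [folklore] -/
theorem apply_one_one_pos {H : Mat} (hH : H ∈ cone) : 0 < (H 1 1).re := by
  obtain ⟨-, hp, hd⟩ := hH
  rw [hdet] at hd
  have hn := Complex.normSq_nonneg (H 0 1)
  by_contra h
  push Not at h
  nlinarith

/-! ### Superadditivity of `√det` and convexity of horoball cones -/

/-- **The `2 × 2` Minkowski determinant inequality**: `√det` is superadditive on the cone.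
[cite: ElstrodtGrunewaldMennicke1998, Ch. 1 §1.1] -/
theorem rdet_add_le {H H' : Mat} (hH : H ∈ cone) (hH' : H' ∈ cone) :
    rdet H + rdet H' ≤ rdet (H + H') := by
  -- coordinates
  set p := (H 0 0).re with hp0
  set r := (H 1 1).re with hr0
  set s := ‖H 0 1‖ with hs0
  set p' := (H' 0 0).re with hp0'
  set r' := (H' 1 1).re with hr0'
  set s' := ‖H' 0 1‖ with hs0'
  have hp : 0 < p := hH.2.1
  have hp' : 0 < p' := hH'.2.1
  have hr : 0 < r := apply_one_one_pos hH
  have hr' : 0 < r' := apply_one_one_pos hH'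
  have hs : 0 ≤ s := norm_nonneg _
  have hs' : 0 ≤ s' := norm_nonneg _
  have hD : hdet H = p * r - s ^ 2 := by rw [hdet, Complex.normSq_eq_norm_sq]
  have hD' : hdet H' = p' * r' - s' ^ 2 := by rw [hdet, Complex.normSq_eq_norm_sq]
  have hDpos : 0 < p * r - s ^ 2 := hD ▸ hH.2.2
  have hDpos' : 0 < p' * r' - s' ^ 2 := hD' ▸ hH'.2.2
  -- the sum
  have hsum : hdet (H + H') = (p + p') * (r + r') - Complex.normSq (H 0 1 + H' 0 1) := by
    simp only [hdet, Matrix.add_apply, Complex.add_re, hp0, hr0, hp0', hr0']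
  have hns : Complex.normSq (H 0 1 + H' 0 1) ≤ s ^ 2 + s' ^ 2 + 2 * s * s' := by
    rw [Complex.normSq_eq_norm_sq]
    have h := norm_add_le (H 0 1) (H' 0 1)
    rw [← hs0, ← hs0'] at h
    nlinarith [norm_nonneg (H 0 1 + H' 0 1)]
  -- `a = √(pr)`, `a' = √(p'r')`
  set a := Real.sqrt (p * r) with ha0
  set a' := Real.sqrt (p' * r') with ha0'
  have ha : a ^ 2 = p * r := Real.sq_sqrt (mul_pos hp hr).le
  have ha' : a' ^ 2 = p' * r' := Real.sq_sqrt (mul_pos hp' hr').le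
  have hapos : 0 ≤ a := Real.sqrt_nonneg _
  have hapos' : 0 ≤ a' := Real.sqrt_nonneg _
  have hsa : s ≤ a := by nlinarith
  have hsa' : s' ≤ a' := by nlinarith
  -- (i) `p r' + p' r ≥ 2 a a'`
  have h1 : 2 * a * a' ≤ p * r' + p' * r := by
    have hsq : (2 * a * a') ^ 2 ≤ (p * r' + p' * r) ^ 2 := by
      nlinarith [sq_nonneg (p * r' - p' * r)]
    have := Real.sqrt_le_sqrt hsq
    rwa [Real.sqrt_sq (by positivity), Real.sqrt_sq (by positivity)] at this
  -- (ii) `a a' - s s' ≥ √D √D'`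
  have h2 : Real.sqrt (hdet H) * Real.sqrt (hdet H') ≤ a * a' - s * s' := by
    rw [← Real.sqrt_mul hH.2.2.le, hD, hD']
    have hnn : 0 ≤ a * a' - s * s' := by nlinarith [mul_le_mul hsa hsa' hs' hapos]
    have hsq : (p * r - s ^ 2) * (p' * r' - s' ^ 2) ≤ (a * a' - s * s') ^ 2 := by
      nlinarith [sq_nonneg (a * s' - a' * s)]
    calc Real.sqrt ((p * r - s ^ 2) * (p' * r' - s' ^ 2))
        ≤ Real.sqrt ((a * a' - s * s') ^ 2) := Real.sqrt_le_sqrt hsq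
      _ = a * a' - s * s' := Real.sqrt_sq hnn
  -- conclude
  rw [rdet, rdet, rdet]
  have hnonneg : 0 ≤ Real.sqrt (hdet H) + Real.sqrt (hdet H') := by positivity
  rw [Real.le_sqrt hnonneg (add_mem_cone hH hH').2.2.le]
  have e1 : Real.sqrt (hdet H) ^ 2 = hdet H := Real.sq_sqrt hH.2.2.le
  have e2 : Real.sqrt (hdet H') ^ 2 = hdet H' := Real.sq_sqrt hH'.2.2.le
  nlinarith

/-- **Horoball cones are convex**: `{H ∈ 𝒫 | H[v] < s · rdet H}` is convex for `s ≥ 0`.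
[cite: ElstrodtGrunewaldMennicke1998, Ch. 2 §2.3] -/
theorem convex_horoballCone (v : Vec) {s : ℝ} (hs : 0 ≤ s) :
    Convex ℝ {H : Mat | H ∈ cone ∧ qf H v < s * rdet H} := by
  intro H hH H' hH' a b ha hb hab
  refine ⟨convex_cone hH.1 hH'.1 ha hb hab, ?_⟩
  rcases ha.lt_or_eq with ha' | rfl
  · rcases hb.lt_or_eq with hb' | rfl
    · -- both positive
      have h1 : qf (a • H) v < s * rdet (a • H) := by
        rw [qf_smul, rdet_smul ha, ← mul_assoc, mul_comm s a, mul_assoc]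
        exact mul_lt_mul_of_pos_left hH.2 ha'
      have h2 : qf (b • H') v < s * rdet (b • H') := by
        rw [qf_smul, rdet_smul hb, ← mul_assoc, mul_comm s b, mul_assoc]
        exact mul_lt_mul_of_pos_left hH'.2 hb'
      have h3 := rdet_add_le (smul_mem_cone ha' hH.1) (smul_mem_cone hb' hH'.1)
      rw [qf_add]
      nlinarith
    · rw [add_zero] at hab
      subst hab
      simpa using hH.2
  · rw [zero_add] at hab
    subst hab
    simpa using hH'.2

/-! ### The product inequality -/

/-- The `2 × 2` determinant of two vectors. [folklore] -/
def det2 (v w : Vec) : ℂ :=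
  v 0 * w 1 - v 1 * w 0

/-- The determinant is unchanged by the shear `(x, y) ↦ (x + c y, y)`. [folklore] -/
theorem det2_shear (c : ℂ) (v w : Vec) :
    (v 0 + c * v 1) * w 1 - v 1 * (w 0 + c * w 1) = det2 v w := by
  rw [det2]; ring

/-- **The product inequality** `H[v] · H[w] ≥ det H · |det(v, w)|²` on the cone.
[cite: ElstrodtGrunewaldMennicke1998, Ch. 2 §2.3] -/
theorem qf_mul_qf_ge {H : Mat} (hH : H ∈ cone) (v w : Vec) :
    hdet H * ‖det2 v w‖ ^ 2 ≤ qf H v * qf H w := by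
  obtain ⟨hherm, hp, hd⟩ := hH
  set P := (H 0 0).re with hP
  set Q := hdet H / P with hQ
  set c := H 0 1 / (P : ℂ) with hc
  have hQpos : 0 < Q := div_pos hd hp
  have hPQ : P * Q = hdet H := by rw [hQ]; field_simp
  -- completing the square
  set x := ‖v 0 + c * v 1‖ with hx
  set y := ‖v 1‖ with hy
  set x' := ‖w 0 + c * w 1‖ with hx'
  set y' := ‖w 1‖ with hy'
  have hv : qf H v = P * x ^ 2 + Q * y ^ 2 := by
    rw [qf_eq_completeSquare hherm hp, Complex.normSq_eq_norm_sq, Complex.normSq_eq_norm_sq]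
  have hw : qf H w = P * x' ^ 2 + Q * y' ^ 2 := by
    rw [qf_eq_completeSquare hherm hp, Complex.normSq_eq_norm_sq, Complex.normSq_eq_norm_sq]
  -- the determinant
  have hdet2 : ‖det2 v w‖ ≤ x * y' + y * x' := by
    rw [← det2_shear c v w]
    calc ‖(v 0 + c * v 1) * w 1 - v 1 * (w 0 + c * w 1)‖
        ≤ ‖(v 0 + c * v 1) * w 1‖ + ‖v 1 * (w 0 + c * w 1)‖ := norm_sub_le _ _
      _ = x * y' + y * x' := by rw [norm_mul, norm_mul]
  have hxy : 0 ≤ x * y' + y * x' := by positivity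
  have hn : 0 ≤ ‖det2 v w‖ := norm_nonneg _
  have h1 : ‖det2 v w‖ ^ 2 ≤ (x * y' + y * x') ^ 2 := pow_le_pow_left₀ hn hdet2 2
  have h2 : hdet H * (x * y' + y * x') ^ 2 ≤ (P * x ^ 2 + Q * y ^ 2) * (P * x' ^ 2 + Q * y' ^ 2) := by
    rw [← hPQ]
    nlinarith [sq_nonneg (P * x * x' - Q * y * y')]
  rw [hv, hw]
  calc hdet H * ‖det2 v w‖ ^ 2 ≤ hdet H * (x * y' + y * x') ^ 2 :=
        mul_le_mul_of_nonneg_left h1 hd.le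
    _ ≤ _ := h2

/-! ### Coercivity -/

/-- An explicit coercivity constant `coer H = min (p/2) (det H · p / (2|z|² + p² + 1))`. [folklore] -/
def coer (H : Mat) : ℝ :=
  min ((H 0 0).re / 2) (hdet H * (H 0 0).re / (2 * Complex.normSq (H 0 1) + (H 0 0).re ^ 2 + 1))

/-- `coer H > 0` on the cone. [folklore] -/
theorem coer_pos {H : Mat} (hH : H ∈ cone) : 0 < coer H := by
  obtain ⟨-, hp, hd⟩ := hH
  refine lt_min (half_pos hp) (div_pos (mul_pos hd hp) ?_)
  nlinarith [Complex.normSq_nonneg (H 0 1)]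

/-- `|a - b|² ≤ 2|a|² + 2|b|²`. [folklore] -/
theorem normSq_sub_le (a b : ℂ) : Complex.normSq (a - b) ≤ 2 * Complex.normSq a + 2 * Complex.normSq b := by
  have h1 := Complex.normSq_sub a b
  have h2 := Complex.normSq_add a b
  have h3 := Complex.normSq_nonneg (a + b)
  linarith

/-- **Coercivity**: `H[v] ≥ coer H · (|v₀|² + |v₁|²)` on the cone. [folklore] -/
theorem qf_ge_coer {H : Mat} (hH : H ∈ cone) (v : Vec) :
    coer H * (Complex.normSq (v 0) + Complex.normSq (v 1)) ≤ qf H v := by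
  have hcoer : 0 ≤ coer H := (coer_pos hH).le
  obtain ⟨hherm, hp, hd⟩ := hH
  set P := (H 0 0).re with hP
  set n := Complex.normSq (H 0 1) with hn
  set c := H 0 1 / (P : ℂ) with hc
  have hnn : 0 ≤ n := Complex.normSq_nonneg _
  have hP0 : P ≠ 0 := hp.ne'
  set A := Complex.normSq (v 0 + c * v 1) with hA
  set B := Complex.normSq (v 1) with hB
  have hA0 : 0 ≤ A := Complex.normSq_nonneg _
  have hB0 : 0 ≤ B := Complex.normSq_nonneg _
  have hqf : qf H v = P * A + hdet H / P * B := qf_eq_completeSquare hherm hp v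
  have hc2 : Complex.normSq c = n / P ^ 2 := by
    rw [hc, Complex.normSq_div, Complex.normSq_ofReal, hn]; ring
  have hv0 : Complex.normSq (v 0) ≤ 2 * A + 2 * (n / P ^ 2) * B := by
    have h : v 0 = (v 0 + c * v 1) - c * v 1 := by ring
    have h' := normSq_sub_le (v 0 + c * v 1) (c * v 1)
    rw [← h, Complex.normSq_mul, hc2] at h'
    linarith
  have hS : Complex.normSq (v 0) + Complex.normSq (v 1) ≤ 2 * A + (2 * n / P ^ 2 + 1) * B := by
    have : 2 * (n / P ^ 2) * B = 2 * n / P ^ 2 * B := by ring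
    linarith
  have hc1 : coer H ≤ P / 2 := min_le_left _ _
  have hcoer2 : coer H ≤ hdet H * P / (2 * n + P ^ 2 + 1) := min_le_right _ _
  have hden : 0 < 2 * n + P ^ 2 + 1 := by positivity
  have hk : 0 ≤ 2 * n / P ^ 2 + 1 := by positivity
  calc coer H * (Complex.normSq (v 0) + Complex.normSq (v 1))
      ≤ coer H * (2 * A + (2 * n / P ^ 2 + 1) * B) := mul_le_mul_of_nonneg_left hS hcoer
    _ = coer H * (2 * A) + coer H * ((2 * n / P ^ 2 + 1) * B) := by ring
    _ ≤ P / 2 * (2 * A) + hdet H * P / (2 * n + P ^ 2 + 1) * ((2 * n / P ^ 2 + 1) * B) :=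
        add_le_add (mul_le_mul_of_nonneg_right hc1 (by positivity))
          (mul_le_mul_of_nonneg_right hcoer2 (by positivity))
    _ ≤ P * A + hdet H / P * B := by
        have h1 : P / 2 * (2 * A) = P * A := by ring
        have h2 : hdet H * P / (2 * n + P ^ 2 + 1) * ((2 * n / P ^ 2 + 1) * B) ≤ hdet H / P * B := by
          have hfrac : hdet H * P / (2 * n + P ^ 2 + 1) * (2 * n / P ^ 2 + 1) ≤ hdet H / P := by
            rw [div_mul_eq_mul_div, div_le_div_iff₀ hden hp]
            have e : hdet H * P * (2 * n / P ^ 2 + 1) * P = hdet H * (2 * n + P ^ 2) := by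
              field_simp
            rw [e]
            nlinarith [hd]
          calc hdet H * P / (2 * n + P ^ 2 + 1) * ((2 * n / P ^ 2 + 1) * B)
              = (hdet H * P / (2 * n + P ^ 2 + 1) * (2 * n / P ^ 2 + 1)) * B := by ring
            _ ≤ hdet H / P * B := mul_le_mul_of_nonneg_right hfrac hB0
        linarith
    _ = qf H v := hqf.symm

/-- `coer` is continuous. [folklore] -/
theorem continuous_coer : Continuous coer := by
  have hc : ∀ i j : Fin 2, Continuous fun H : Mat => H i j := fun i j =>
    (continuous_apply j).comp (continuous_apply i)
  have hp : Continuous fun H : Mat => (H 0 0).re := Complex.continuous_re.comp (hc 0 0)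
  have hr : Continuous fun H : Mat => (H 1 1).re := Complex.continuous_re.comp (hc 1 1)
  have hn : Continuous fun H : Mat => Complex.normSq (H 0 1) := Complex.continuous_normSq.comp (hc 0 1)
  have hd : Continuous hdet := (hp.mul hr).sub hn
  refine (hp.div_const 2).min ((hd.mul hp).div (((continuous_const.mul hn).add (hp.pow 2)).add
    continuous_const) fun H => ?_)
  have h0 := Complex.normSq_nonneg (H 0 1)
  exact (by positivity : (0 : ℝ) < 2 * Complex.normSq (H 0 1) + (H 0 0).re ^ 2 + 1).ne'

/-- `hdet` is continuous. [folklore] -/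
theorem continuous_hdet : Continuous hdet := by
  have hc : ∀ i j : Fin 2, Continuous fun H : Mat => H i j := fun i j =>
    (continuous_apply j).comp (continuous_apply i)
  exact ((Complex.continuous_re.comp (hc 0 0)).mul (Complex.continuous_re.comp (hc 1 1))).sub
    (Complex.continuous_normSq.comp (hc 0 1))

/-- `rdet` is continuous. [folklore] -/
theorem continuous_rdet : Continuous rdet :=
  Real.continuous_sqrt.comp continuous_hdet

/-- `qf · v` is continuous in the matrix. [folklore] -/
theorem continuous_qf (v : Vec) : Continuous fun H : Mat => qf H v :=
  Complex.continuous_re.comp (continuous_const.dotProduct (continuous_id.matrix_mulVec continuous_const))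

end BianchiCone

end Literature.NumberTheory.Automorphic
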